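import Summits.NavierStokesRegularity.NavierStokesRegularity.Theorems.PerpetualPumpThesisTameDuhamelBoundParaproduct
import Summits.NavierStokesRegularity.NavierStokesRegularity.Theorems.PerpetualPumpThesisTameDuhamelBoundDuality
import Summits.NavierStokesRegularity.NavierStokesRegularity.Theorems.PerpetualPumpThesisBesovDuhamelBound
import Summits.NavierStokesRegularity.NavierStokesRegularity.Theorems.PerpetualPumpThesisBilinearOperatorForm

/-!
# Stub `tameDuhamelBound` for `PerpetualPump.Thesis`: the tame bound for the averaged form and the
# tame `H¹⁰`–Duhamel bound along `H¹⁰_df`-mild solutions of an averaged Navier–Stokes equation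

Final file of the stub `tameDuhamelBound` of line `SketchIdeator2` (crux
stmt-NavierStokesRegularity-1832), proving the registered statement `stub_tameDuhamelBound`: for every
averaging datum `𝒜` (T. Tao, J. Amer. Math. Soc. 29 (2016), (1.12)–(1.15); no symmetry or
cancellation needed) there is `C ≥ 0` such that every mild `H¹⁰_df` solution `u` of
`∂ₜu = Δu + B̃(u,u)` on `[0,T)` obeys, for `0 ≤ t₁ ≤ t < T`, `‖u(s)‖_{Ḃ⁰_{∞,1}} ≤ M` and
`‖u(s)‖_{H¹⁰} ≤ R` on `[t₁,t]`, `‖u(t)‖_{H¹⁰} ≤ ‖u(t₁)‖_{H¹⁰} + C (√(t-t₁) + (t-t₁)) M R`.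

* `FB.exists_enorm_form_le_tame` (registered sub-goal `stub_FB_Form`): the **tame bound for Tao's
  averaged form** `⟨B̃(f,g), w⟩ = ∫_Ω ⟨B(A₁f, A₂g), A₃w⟩ dμ(θ)`,
  `|⟨B̃(f,g), w⟩| ≤ K (‖f‖_{Ḃ⁰_{∞,1}} ‖g‖_{H¹⁰} + ‖f‖_{H¹⁰} ‖g‖_{Ḃ⁰_{∞,1}}) ‖w‖_{H⁻⁹}` — the tame
  paraproduct estimate of part VI slot by slot, the slots bounded on `Ḃ⁰_{∞,1}`
  (`FB.exists_eHomBesovNorm_slot_le`: `m(D)`, `Rot`, `Dil` are bounded on `Ḃ⁰_{∞,1}`, part Slot of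
  stub `besovDuhamelBound`), on `H¹⁰` and on `H⁻⁹`, and Tao's moment bounds;
* `FB.tameDuhamelBound`: the `H¹⁰` norm of `u(t) ∈ H¹⁰_df` is computed by duality against
  `w ∈ H¹⁰_df` (part Duality); by the restarted Duhamel identity (part Duhamel of stub
  `besovFloorBound`) `⟨u(t), w⟩ = ⟨e^{(t-t₁)Δ}u(t₁), w⟩ + ∫_{t₁}^{t} ⟨B̃(u(s),u(s)), e^{(t-s)Δ}w⟩ ds`;
  the free term is `≤ ‖u(t₁)‖_{H¹⁰}‖w‖_{H⁻¹⁰}` (heat is an `H¹⁰` contraction, no constant), the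
  Duhamel term is bounded by the tame form bound and the parabolic gain
  `‖e^{σΔ}w‖_{H⁻⁹} ≤ (1 + σ^{-1/2})‖w‖_{H⁻¹⁰}`, whose time integral is
  `(t-t₁) + 2√(t-t₁) ≤ 2(√(t-t₁) + (t-t₁))`.

## References

* T. Tao, J. Amer. Math. Soc. 29 (2016), 601–674, §1.1 (1.10)–(1.15).
* H. Bahouri, J.-Y. Chemin, R. Danchin, *Fourier Analysis and Nonlinear PDE* (2011), §2.6, Cor. 2.86.
-/

noncomputable section

open MeasureTheory Filter Topology FourierTransform Real Complex Set
open scoped SchwartzMap ENNReal NNReal FourierTransform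

set_option linter.dupNamespace false

namespace Summit.NavierStokesRegularity.NavierStokesRegularity.Theorems.PerpetualPumpThesis.FB

open Literature.Analysis.FunctionSpaces Literature.Analysis.FluidPDE
  Literature.Analysis.FluidPDE.Tao2016

/-! ### The slots on `Ḃ⁰_{∞,1}` -/

/-- **Tao's slots are bounded on `Ḃ⁰_{∞,1} ∩ L²`**: for every averaging datum `𝒜` there are `n`, `C`
with `‖Aᵢ(θ) f‖_{Ḃ⁰_{∞,1}} ≤ C (∑_{j≤n} ‖m_{i,θ}‖_j) ‖f‖_{Ḃ⁰_{∞,1}}` for all `i`, `θ`, `f ∈ L²(ℝ³; ℂ³)`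
(`m(D)`, `Rot_R`, `Dil_λ` with `λ ∈ [C⁻¹, C]` are bounded on `Ḃ⁰_{∞,1}`). -/
theorem exists_eHomBesovNorm_slot_le (𝒜 : AveragingDatum) :
    ∃ (n : ℕ) (C : ℝ≥0), ∀ (i : Fin 3) (θ : 𝒜.Ω) (f : L2C),
      eHomBesovNorm 0 ∞ 1 ((𝒜.slot i θ f : L2C) : 𝓢'(EuclideanSpace ℝ (Fin 3), EuclideanSpace ℂ (Fin 3))) ≤
        C * ENNReal.ofReal (∑ j ∈ Finset.range (n + 1), (symbolSeminorm j (𝒜.m i θ)).toReal) *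
          eHomBesovNorm 0 ∞ 1 ((f : L2C) : 𝓢'(EuclideanSpace ℝ (Fin 3), EuclideanSpace ℂ (Fin 3))) := by
  -- adapted from `FA.exists_eLpNorm_slot_le` (part Slot of stub `besovDuhamelBound`), without the
  -- final embedding `Ḃ⁰_{∞,1} ⊂ L^∞`
  obtain ⟨CL, hCL⟩ := 𝒜.lam_bdd
  obtain ⟨N, hN⟩ := pow_unbounded_of_one_lt CL one_lt_two
  obtain ⟨n, Cm, hCm⟩ := FA.exists_eHomBesovNorm_coe_fourierMultiplier_le
  obtain ⟨Cr, hCr⟩ := FA.exists_eHomBesovNorm_coe_rot_le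
  obtain ⟨Cd, hCd⟩ := FA.exists_eHomBesovNorm_coe_dil_le N
  refine ⟨n, Cm * Cr * Cd, fun i θ f => ?_⟩
  have hlam0 : 0 < 𝒜.lam i θ := 𝒜.lam_pos i θ
  have hρ₂ : 𝒜.lam i θ ≤ (2 : ℝ) ^ (N : ℤ) := by
    rw [zpow_natCast]
    exact ((hCL i θ).2.trans hN.le)
  have hρ₁ : (2 : ℝ) ^ (-(N : ℤ)) ≤ 𝒜.lam i θ := by
    have hCL0 : 0 < CL := hlam0.trans_le (hCL i θ).2
    rw [zpow_neg, zpow_natCast]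
    calc ((2 : ℝ) ^ N)⁻¹ ≤ CL⁻¹ := by
          rw [inv_le_inv₀ (by positivity) hCL0]; exact hN.le
      _ ≤ 𝒜.lam i θ := (hCL i θ).1
  calc eHomBesovNorm 0 ∞ 1 ((𝒜.slot i θ f : L2C) : 𝓢'(EuclideanSpace ℝ (Fin 3), EuclideanSpace ℂ (Fin 3)))
      ≤ Cm * ENNReal.ofReal (∑ j ∈ Finset.range (n + 1), (symbolSeminorm j (𝒜.m i θ)).toReal) *
          eHomBesovNorm 0 ∞ 1 ((rot (𝒜.R i θ) (dil (𝒜.lam i θ) f) : L2C) :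
            𝓢'(EuclideanSpace ℝ (Fin 3), EuclideanSpace ℂ (Fin 3))) :=
        hCm (𝒜.m i θ) (𝒜.isRealSymbol i θ) _
    _ ≤ Cm * ENNReal.ofReal (∑ j ∈ Finset.range (n + 1), (symbolSeminorm j (𝒜.m i θ)).toReal) *
          (Cr * (Cd * eHomBesovNorm 0 ∞ 1 ((f : L2C) :
            𝓢'(EuclideanSpace ℝ (Fin 3), EuclideanSpace ℂ (Fin 3))))) := by
        gcongr
        exact (hCr _ _).trans (mul_le_mul' le_rfl (hCd _ hρ₁ hρ₂ f))
    _ = ((Cm * Cr * Cd : ℝ≥0) : ℝ≥0∞) *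
          ENNReal.ofReal (∑ j ∈ Finset.range (n + 1), (symbolSeminorm j (𝒜.m i θ)).toReal) *
          eHomBesovNorm 0 ∞ 1 ((f : L2C) : 𝓢'(EuclideanSpace ℝ (Fin 3), EuclideanSpace ℂ (Fin 3))) := by
        rw [ENNReal.coe_mul, ENNReal.coe_mul]
        ring

/-- `‖m‖₀` is one of the summands of `∑_{j≤n} ‖m‖_j`. -/
theorem symbolSeminorm_zero_le_sum (n : ℕ) (m : EuclideanSpace ℝ (Fin 3) → ℂ) :
    symbolSeminorm 0 m ≤ ∑ j ∈ Finset.range (n + 1), symbolSeminorm j m :=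
  Finset.single_le_sum (f := fun j => symbolSeminorm j m) (fun _ _ => zero_le)
    (Finset.mem_range.2 (Nat.succ_pos n))

/-! ### The tame bound for the averaged form -/

/-- **The tame bound for the averaged form `⟨B̃(f,g), w⟩`.** For every averaging datum `𝒜` there is
`K < ∞` such that for all divergence-free `f, g ∈ L²(ℝ³; ℂ³)` of finite `H¹⁰` norm and all `w ∈ L²`,
`|⟨B̃(f,g), w⟩| ≤ K (‖f‖_{Ḃ⁰_{∞,1}} ‖g‖_{H¹⁰} + ‖f‖_{H¹⁰} ‖g‖_{Ḃ⁰_{∞,1}}) ‖w‖_{H⁻⁹}` (the tame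
paraproduct estimate for `B` slot by slot, the slot bounds on `Ḃ⁰_{∞,1}`, `H¹⁰`, `H⁻⁹`, and Tao's
moment bounds `𝔼 (∑_{j≤n}‖m₁‖_j)(∑_{j≤n}‖m₂‖_j)‖m₃‖₀ < ∞`). -/
theorem exists_enorm_form_le_tame (𝒜 : AveragingDatum) :
    ∃ K : ℝ≥0∞, K ≠ ⊤ ∧ ∀ f g w : L2C, IsFourierDivFree f → IsFourierDivFree g →
      eFourierSobolevNorm 10 f < ⊤ → eFourierSobolevNorm 10 g < ⊤ →
      ‖𝒜.form f g w‖ₑ ≤ K *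
        (eHomBesovNorm 0 ∞ 1 ((f : L2C) : 𝓢'(EuclideanSpace ℝ (Fin 3), EuclideanSpace ℂ (Fin 3))) *
            eFourierSobolevNorm 10 g +
          eFourierSobolevNorm 10 f *
            eHomBesovNorm 0 ∞ 1 ((g : L2C) : 𝓢'(EuclideanSpace ℝ (Fin 3), EuclideanSpace ℂ (Fin 3)))) *
        eFourierSobolevNorm (-9) w := by
  obtain ⟨C, hC⟩ := 𝒜.lam_bdd
  obtain ⟨n, CB, hCB⟩ := exists_eHomBesovNorm_slot_le 𝒜
  set 𝒟 := 𝒜.toComplex with h𝒟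
  -- the constants
  set Kt : ℝ≥0∞ := ENNReal.ofReal (72 * π) * 2 ^ 40 * (3 : ℝ≥0∞) ^ (1 / 2 : ℝ) * (11 : ℝ≥0∞) ^ (1 / 2 : ℝ) +
      5 * (ENNReal.ofReal (72 * π) * 2 ^ 80) with hKt
  set M10 : ℝ≥0∞ := ENNReal.ofReal (max 1 C ^ (10 : ℝ)) with hM10
  set M9 : ℝ≥0∞ := ENNReal.ofReal (max 1 C ^ (-(-9) : ℝ)) with hM9
  set Sf : Fin 3 → ℕ → 𝒜.Ω → ℝ≥0∞ := fun i n θ => ∑ j ∈ Finset.range (n + 1), symbolSeminorm j (𝒜.m i θ)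
    with hSf
  have hSfm : ∀ i n, Measurable (Sf i n) := fun i n =>
    Finset.measurable_sum _ fun j _ => 𝒜.measurable_symbolSeminorm i j
  set Mom : ℝ≥0∞ := ∫⁻ θ, Sf 0 n θ * Sf 1 n θ * Sf 2 0 θ ∂𝒜.μ with hMom
  have hMomfin : Mom < ⊤ := FA.lintegral_sum_symbolSeminorm_lt_top 𝒜 n n 0
  have hKt_top : Kt ≠ ⊤ := by
    rw [hKt]
    refine ENNReal.add_ne_top.2 ⟨?_, ?_⟩
    · exact ENNReal.mul_ne_top (ENNReal.mul_ne_top (ENNReal.mul_ne_top ENNReal.ofReal_ne_top (by simp))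
        (ENNReal.rpow_ne_top_of_nonneg (by norm_num) (by simp)))
        (ENNReal.rpow_ne_top_of_nonneg (by norm_num) (by simp))
    · exact ENNReal.mul_ne_top (by simp) (ENNReal.mul_ne_top ENNReal.ofReal_ne_top (by simp))
  set K : ℝ≥0∞ := Kt * CB * M10 * M9 * Mom with hK
  have hKfin : K ≠ ⊤ :=
    ENNReal.mul_ne_top (ENNReal.mul_ne_top (ENNReal.mul_ne_top (ENNReal.mul_ne_top hKt_top ENNReal.coe_ne_top)
      ENNReal.ofReal_ne_top) ENNReal.ofReal_ne_top) hMomfin.ne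
  refine ⟨K, hKfin, fun f g w hf hg hf10 hg10 => ?_⟩
  -- abbreviations for the norms of the data
  set Bf : ℝ≥0∞ := eHomBesovNorm 0 ∞ 1 ((f : L2C) : 𝓢'(EuclideanSpace ℝ (Fin 3), EuclideanSpace ℂ (Fin 3)))
    with hBf
  set Bg : ℝ≥0∞ := eHomBesovNorm 0 ∞ 1 ((g : L2C) : 𝓢'(EuclideanSpace ℝ (Fin 3), EuclideanSpace ℂ (Fin 3)))
    with hBg
  -- pointwise in `θ`
  have hpt : ∀ θ, ‖eulerForm (𝒜.slot 0 θ f) (𝒜.slot 1 θ g) (𝒜.slot 2 θ w)‖ₑ ≤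
      Kt * CB * M10 * M9 * (Bf * eFourierSobolevNorm 10 g + eFourierSobolevNorm 10 f * Bg) *
        eFourierSobolevNorm (-9) w * (Sf 0 n θ * Sf 1 n θ * Sf 2 0 θ) := by
    intro θ
    have hCpos : 0 < C := lt_of_lt_of_le (𝒜.lam_pos 0 θ) (hC 0 θ).2
    have hK10 : ∀ i, ENNReal.ofReal (max 1 (𝒜.lam i θ) ^ (10 : ℝ)) ≤ M10 := fun i =>
      ENNReal.ofReal_le_ofReal (Real.rpow_le_rpow (by positivity) (max_le_max le_rfl (hC i θ).2) (by norm_num))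
    have hK9 : ENNReal.ofReal (max 1 (𝒜.lam 2 θ)⁻¹ ^ (-(-9) : ℝ)) ≤ M9 := by
      refine ENNReal.ofReal_le_ofReal (Real.rpow_le_rpow (by positivity) (max_le_max le_rfl ?_) (by norm_num))
      have h := (hC 2 θ).1
      rwa [inv_le_comm₀ hCpos (𝒜.lam_pos 2 θ)] at h
    have hm0 : ∀ i, symbolSeminorm 0 (𝒜.m i θ) ≤ Sf i n θ := fun i => symbolSeminorm_zero_le_sum n _
    have hm2 : symbolSeminorm 0 (𝒜.m 2 θ) ≤ Sf 2 0 θ := symbolSeminorm_zero_le_sum 0 _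
    -- the slots
    have hF : IsFourierDivFree (𝒜.slot 0 θ f) := FA.isFourierDivFree_slot 𝒜 0 θ hf
    have hG : IsFourierDivFree (𝒜.slot 1 θ g) := FA.isFourierDivFree_slot 𝒜 1 θ hg
    have hF10 : eFourierSobolevNorm 10 (𝒜.slot 0 θ f) < ⊤ := 𝒟.eFourierSobolevNorm_slot_lt_top 0 θ hf10
    have hG10 : eFourierSobolevNorm 10 (𝒜.slot 1 θ g) < ⊤ := 𝒟.eFourierSobolevNorm_slot_lt_top 1 θ hg10
    have h0 : eFourierSobolevNorm 10 (𝒜.slot 0 θ f) ≤ Sf 0 n θ * (M10 * eFourierSobolevNorm 10 f) := by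
      refine (𝒟.eFourierSobolevNorm_slot_le 0 θ (by norm_num : (0 : ℝ) ≤ 10) f).trans ?_
      rw [mul_assoc]
      exact mul_le_mul' (hm0 0) (mul_le_mul' (hK10 0) le_rfl)
    have h1 : eFourierSobolevNorm 10 (𝒜.slot 1 θ g) ≤ Sf 1 n θ * (M10 * eFourierSobolevNorm 10 g) := by
      refine (𝒟.eFourierSobolevNorm_slot_le 1 θ (by norm_num : (0 : ℝ) ≤ 10) g).trans ?_
      rw [mul_assoc]
      exact mul_le_mul' (hm0 1) (mul_le_mul' (hK10 1) le_rfl)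
    have h2 : eFourierSobolevNorm (-9) (𝒜.slot 2 θ w) ≤ Sf 2 0 θ * (M9 * eFourierSobolevNorm (-9) w) := by
      refine (B.eFourierSobolevNorm_slot_le_of_nonpos 𝒟 2 θ (by norm_num : (-9 : ℝ) ≤ 0) w).trans ?_
      rw [mul_assoc]
      exact mul_le_mul' hm2 (mul_le_mul' hK9 le_rfl)
    have hB0 : eHomBesovNorm 0 ∞ 1 ((𝒜.slot 0 θ f : L2C) :
        𝓢'(EuclideanSpace ℝ (Fin 3), EuclideanSpace ℂ (Fin 3))) ≤ CB * Sf 0 n θ * Bf := by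
      refine (hCB 0 θ f).trans ?_
      gcongr
      exact FA.ofReal_sum_toReal_le _
    have hB1 : eHomBesovNorm 0 ∞ 1 ((𝒜.slot 1 θ g : L2C) :
        𝓢'(EuclideanSpace ℝ (Fin 3), EuclideanSpace ℂ (Fin 3))) ≤ CB * Sf 1 n θ * Bg := by
      refine (hCB 1 θ g).trans ?_
      gcongr
      exact FA.ofReal_sum_toReal_le _
    calc ‖eulerForm (𝒜.slot 0 θ f) (𝒜.slot 1 θ g) (𝒜.slot 2 θ w)‖ₑ
        ≤ Kt * (eHomBesovNorm 0 ∞ 1 ((𝒜.slot 0 θ f : L2C) :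
              𝓢'(EuclideanSpace ℝ (Fin 3), EuclideanSpace ℂ (Fin 3))) * eFourierSobolevNorm 10 (𝒜.slot 1 θ g) +
            eFourierSobolevNorm 10 (𝒜.slot 0 θ f) * eHomBesovNorm 0 ∞ 1 ((𝒜.slot 1 θ g : L2C) :
              𝓢'(EuclideanSpace ℝ (Fin 3), EuclideanSpace ℂ (Fin 3)))) *
            eFourierSobolevNorm (-9) (𝒜.slot 2 θ w) := enorm_eulerForm_le_tame _ hF hG hF10 hG10
      _ ≤ Kt * ((CB * Sf 0 n θ * Bf) * (Sf 1 n θ * (M10 * eFourierSobolevNorm 10 g)) +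
            (Sf 0 n θ * (M10 * eFourierSobolevNorm 10 f)) * (CB * Sf 1 n θ * Bg)) *
            (Sf 2 0 θ * (M9 * eFourierSobolevNorm (-9) w)) := by gcongr
      _ = Kt * CB * M10 * M9 * (Bf * eFourierSobolevNorm 10 g + eFourierSobolevNorm 10 f * Bg) *
            eFourierSobolevNorm (-9) w * (Sf 0 n θ * Sf 1 n θ * Sf 2 0 θ) := by ring
  -- integrate
  unfold AveragingDatum.form
  refine (enorm_integral_le_lintegral_enorm _).trans ?_
  have hprod : Measurable fun θ => Sf 0 n θ * Sf 1 n θ * Sf 2 0 θ :=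
    ((hSfm 0 n).mul (hSfm 1 n)).mul (hSfm 2 0)
  calc ∫⁻ θ, ‖eulerForm (𝒜.slot 0 θ f) (𝒜.slot 1 θ g) (𝒜.slot 2 θ w)‖ₑ ∂𝒜.μ
      ≤ ∫⁻ θ, Kt * CB * M10 * M9 * (Bf * eFourierSobolevNorm 10 g + eFourierSobolevNorm 10 f * Bg) *
          eFourierSobolevNorm (-9) w * (Sf 0 n θ * Sf 1 n θ * Sf 2 0 θ) ∂𝒜.μ := lintegral_mono hpt
    _ = Kt * CB * M10 * M9 * (Bf * eFourierSobolevNorm 10 g + eFourierSobolevNorm 10 f * Bg) *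
          eFourierSobolevNorm (-9) w * Mom := by
        rw [hMom, lintegral_const_mul _ hprod]
    _ = K * (Bf * eFourierSobolevNorm 10 g + eFourierSobolevNorm 10 f * Bg) * eFourierSobolevNorm (-9) w := by
        rw [hK]; ring

/-! ### The time integral of the parabolic gain -/

/-- The parabolic gain factor `s ↦ 1 + (t-s)^{-1/2}` is measurable (as an `ℝ≥0∞`-valued function). -/
theorem measurable_gain (t : ℝ) :
    Measurable fun s : ℝ => ENNReal.ofReal (1 + (t - s) ^ (-(1 / 2 : ℝ))) :=
  (measurable_const.add ((measurable_const.sub measurable_id).pow_const _)).ennreal_ofReal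

/-- **`∫_{t₁}^{t} (1 + (t-s)^{-1/2}) ds = (t-t₁) + 2√(t-t₁)`** as a lower Lebesgue integral. -/
theorem lintegral_Ioo_gain {t₁ t : ℝ} (h : t₁ ≤ t) :
    ∫⁻ s in Ioo t₁ t, ENNReal.ofReal (1 + (t - s) ^ (-(1 / 2 : ℝ))) =
      ENNReal.ofReal (t - t₁) + ENNReal.ofReal (2 * Real.sqrt (t - t₁)) := by
  have hsplit : ∀ s ∈ Ioo t₁ t, ENNReal.ofReal (1 + (t - s) ^ (-(1 / 2 : ℝ))) =
      1 + ENNReal.ofReal ((t - s) ^ (-(1 / 2 : ℝ))) := fun s hs => by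
    rw [ENNReal.ofReal_add zero_le_one (Real.rpow_nonneg (sub_nonneg.2 hs.2.le) _), ENNReal.ofReal_one]
  rw [setLIntegral_congr_fun measurableSet_Ioo hsplit, lintegral_add_left measurable_const,
    setLIntegral_one, Real.volume_Ioo, FA.lintegral_Ioo_rpow_neg_half h]

/-! ### The Duhamel term -/

/-- **Bound of the Duhamel integrand**: along a mild solution, for `s ∈ (t₁, t)` with
`‖u(s)‖_{Ḃ⁰_{∞,1}} ≤ M`, `‖u(s)‖_{H¹⁰} ≤ R`,
`|⟨B̃(u(s),u(s)), e^{(t-s)Δ}w⟩| ≤ 2K M R (1 + (t-s)^{-1/2}) ‖w‖_{H⁻¹⁰}` (tame form bound + parabolic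
gain). -/
theorem enorm_form_heat_le (𝒜 : AveragingDatum) {K : ℝ≥0∞}
    (hK : ∀ f g w : L2C, IsFourierDivFree f → IsFourierDivFree g →
      eFourierSobolevNorm 10 f < ⊤ → eFourierSobolevNorm 10 g < ⊤ →
      ‖𝒜.form f g w‖ₑ ≤ K *
        (eHomBesovNorm 0 ∞ 1 ((f : L2C) : 𝓢'(EuclideanSpace ℝ (Fin 3), EuclideanSpace ℂ (Fin 3))) *
            eFourierSobolevNorm 10 g +
          eFourierSobolevNorm 10 f *
            eHomBesovNorm 0 ∞ 1 ((g : L2C) : 𝓢'(EuclideanSpace ℝ (Fin 3), EuclideanSpace ℂ (Fin 3)))) *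
        eFourierSobolevNorm (-9) w)
    {f : L2C} (hf : MemH10df f) {M R : ℝ}
    (hM : eHomBesovNorm 0 ∞ 1 ((f : L2C) : 𝓢'(EuclideanSpace ℝ (Fin 3), EuclideanSpace ℂ (Fin 3))) ≤
      ENNReal.ofReal M)
    (hR : eFourierSobolevNorm 10 f ≤ ENNReal.ofReal R) {σ : ℝ} (hσ : 0 < σ) (w : L2C) :
    ‖𝒜.form f f (heat σ w)‖ₑ ≤
      2 * K * ENNReal.ofReal M * ENNReal.ofReal R * eFourierSobolevNorm (-10) w *
        ENNReal.ofReal (1 + σ ^ (-(1 / 2 : ℝ))) := by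
  refine (hK f f (heat σ w) hf.2.2 hf.2.2 hf.1 hf.1).trans ?_
  calc K * (eHomBesovNorm 0 ∞ 1 ((f : L2C) : 𝓢'(EuclideanSpace ℝ (Fin 3), EuclideanSpace ℂ (Fin 3))) *
          eFourierSobolevNorm 10 f +
        eFourierSobolevNorm 10 f *
          eHomBesovNorm 0 ∞ 1 ((f : L2C) : 𝓢'(EuclideanSpace ℝ (Fin 3), EuclideanSpace ℂ (Fin 3)))) *
        eFourierSobolevNorm (-9) (heat σ w)
      ≤ K * (ENNReal.ofReal M * ENNReal.ofReal R + ENNReal.ofReal R * ENNReal.ofReal M) *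
          (ENNReal.ofReal (1 + σ ^ (-(1 / 2 : ℝ))) * eFourierSobolevNorm (-10) w) := by
        gcongr
        exact eFourierSobolevNorm_heat_neg_nine_le hσ w
    _ = _ := by ring

/-- **The Duhamel term through duality**: along a mild `H¹⁰_df` solution with
`‖u(s)‖_{Ḃ⁰_{∞,1}} ≤ M`, `‖u(s)‖_{H¹⁰} ≤ R` on `[t₁, t]`,
`|∫_{t₁}^{t} ⟨B̃(u(s),u(s)), e^{(t-s)Δ}w⟩ ds| ≤ 2K M R ((t-t₁) + 2√(t-t₁)) ‖w‖_{H⁻¹⁰}`. -/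
theorem enorm_duhamel_le (𝒜 : AveragingDatum) {K : ℝ≥0∞}
    (hK : ∀ f g w : L2C, IsFourierDivFree f → IsFourierDivFree g →
      eFourierSobolevNorm 10 f < ⊤ → eFourierSobolevNorm 10 g < ⊤ →
      ‖𝒜.form f g w‖ₑ ≤ K *
        (eHomBesovNorm 0 ∞ 1 ((f : L2C) : 𝓢'(EuclideanSpace ℝ (Fin 3), EuclideanSpace ℂ (Fin 3))) *
            eFourierSobolevNorm 10 g +
          eFourierSobolevNorm 10 f *
            eHomBesovNorm 0 ∞ 1 ((g : L2C) : 𝓢'(EuclideanSpace ℝ (Fin 3), EuclideanSpace ℂ (Fin 3)))) *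
        eFourierSobolevNorm (-9) w)
    {a : L2C} {T : ℝ} {u : ℝ → L2C} (hu : IsMildSolutionFor 𝒜.form a (Ico 0 T) u)
    {t₁ t M R : ℝ} (ht₁ : 0 ≤ t₁) (ht₁t : t₁ ≤ t) (htT : t < T)
    (hB : ∀ s ∈ Icc t₁ t, eHomBesovNorm 0 ∞ 1 ((u s : L2C) :
      𝓢'(EuclideanSpace ℝ (Fin 3), EuclideanSpace ℂ (Fin 3))) ≤ ENNReal.ofReal M)
    (hH : ∀ s ∈ Icc t₁ t, eFourierSobolevNorm 10 (u s) ≤ ENNReal.ofReal R) (w : L2C) :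
    ‖∫ s in t₁..t, 𝒜.form (u s) (u s) (heat (t - s) w)‖ₑ ≤
      2 * K * ENNReal.ofReal M * ENNReal.ofReal R * eFourierSobolevNorm (-10) w *
        (ENNReal.ofReal (t - t₁) + ENNReal.ofReal (2 * Real.sqrt (t - t₁))) := by
  rw [intervalIntegral.integral_of_le ht₁t]
  refine (enorm_integral_le_lintegral_enorm _).trans ?_
  rw [← Measure.restrict_congr_set Ioo_ae_eq_Ioc, ← lintegral_Ioo_gain ht₁t,
    ← lintegral_const_mul _ (measurable_gain t)]
  refine setLIntegral_mono' measurableSet_Ioo fun s hs => ?_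
  have hsI : s ∈ Icc t₁ t := ⟨hs.1.le, hs.2.le⟩
  have hmem : MemH10df (u s) := hu.1 s ⟨ht₁.trans hs.1.le, hs.2.trans htT⟩
  exact enorm_form_heat_le 𝒜 hK hmem (hB s hsI) (hH s hsI) (sub_pos.2 hs.2) w

/-! ### The tame `H¹⁰`–Duhamel bound -/

/-- **The tame `H¹⁰`–Duhamel bound** (the mathematics of `stub_tameDuhamelBound`): for every
averaging datum `𝒜` there is `C ≥ 0` such that every mild `H¹⁰_df` solution `u` on `[0,T)` obeys,
for `0 ≤ t₁ ≤ t < T`, `0 ≤ M`, `0 ≤ R`, `‖u(s)‖_{Ḃ⁰_{∞,1}} ≤ M` and `‖u(s)‖_{H¹⁰} ≤ R` on `[t₁, t]`,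
`‖u(t)‖_{H¹⁰} ≤ ‖u(t₁)‖_{H¹⁰} + C (√(t-t₁) + (t-t₁)) M R`. -/
theorem tameDuhamelBound (𝒜 : AveragingDatum) :
    ∃ C : ℝ, 0 ≤ C ∧ ∀ (a : L2C) (T : ℝ) (u : ℝ → L2C),
      IsMildSolutionFor 𝒜.form a (Ico 0 T) u → ∀ t₁ t M R : ℝ, 0 ≤ t₁ → t₁ ≤ t → t < T → 0 ≤ M → 0 ≤ R →
      (∀ s ∈ Icc t₁ t, eHomBesovNorm 0 ⊤ 1 ((u s : L2C) :
        𝓢'(EuclideanSpace ℝ (Fin 3), EuclideanSpace ℂ (Fin 3))) ≤ ENNReal.ofReal M) →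
      (∀ s ∈ Icc t₁ t, eFourierSobolevNorm 10 (u s) ≤ ENNReal.ofReal R) →
      eFourierSobolevNorm 10 (u t) ≤
        eFourierSobolevNorm 10 (u t₁) + ENNReal.ofReal (C * (Real.sqrt (t - t₁) + (t - t₁)) * M * R) := by
  obtain ⟨K, hKfin, hK⟩ := exists_enorm_form_le_tame 𝒜
  set k : ℝ := K.toReal with hk
  have hk0 : 0 ≤ k := ENNReal.toReal_nonneg
  have hKeq : K = ENNReal.ofReal k := (ENNReal.ofReal_toReal hKfin).symm
  refine ⟨4 * k, by positivity, fun a T u hu t₁ t M R ht₁ ht₁t htT hM hR hB hH => ?_⟩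
  set Δ : ℝ := t - t₁ with hΔ
  have hΔ0 : 0 ≤ Δ := sub_nonneg.2 ht₁t
  set E : ℝ≥0∞ := ENNReal.ofReal (4 * k * (Real.sqrt Δ + Δ) * M * R) with hE
  have hz : MemH10df (u t) := hu.1 t ⟨ht₁.trans ht₁t, htT⟩
  -- the Duhamel error is dominated by `E`
  have hX : 2 * K * ENNReal.ofReal M * ENNReal.ofReal R *
      (ENNReal.ofReal Δ + ENNReal.ofReal (2 * Real.sqrt Δ)) ≤ E := by
    have heq : 2 * K * ENNReal.ofReal M * ENNReal.ofReal R *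
        (ENNReal.ofReal Δ + ENNReal.ofReal (2 * Real.sqrt Δ)) =
        ENNReal.ofReal (2 * k * M * R * (Δ + 2 * Real.sqrt Δ)) := by
      have h4 : (0 : ℝ) ≤ 2 * k * M * R := by positivity
      have h3 : (0 : ℝ) ≤ 2 * k * M := by positivity
      have h2 : (0 : ℝ) ≤ 2 * k := by positivity
      rw [hKeq, ENNReal.ofReal_mul h4, ENNReal.ofReal_add hΔ0 (by positivity), ENNReal.ofReal_mul h3,
        ENNReal.ofReal_mul h2]
      simp only [ENNReal.ofReal_mul zero_le_two, ENNReal.ofReal_ofNat]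
    rw [heq, hE]
    refine ENNReal.ofReal_le_ofReal ?_
    have hs0 : 0 ≤ Real.sqrt Δ := Real.sqrt_nonneg _
    nlinarith [mul_nonneg (mul_nonneg hk0 hM) hR, mul_nonneg (mul_nonneg (mul_nonneg hk0 hM) hR) hΔ0]
  -- duality
  refine eFourierSobolevNorm_ten_le_of_pairing_bound hz fun w hw => ?_
  rw [PerpetualPumpThesis.F.pairing_eq_restart 𝒜 hu ht₁ ht₁t htT hw]
  refine (enorm_add_le _ _).trans ?_
  have h1 : ‖pairing (heat (t - t₁) (u t₁)) w‖ₑ ≤ eFourierSobolevNorm 10 (u t₁) * eFourierSobolevNorm (-10) w :=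
    (enorm_pairing_le 10 _ _).trans (mul_le_mul' (eFourierSobolevNorm_heat_le _ _ _) le_rfl)
  have h2 := enorm_duhamel_le 𝒜 hK hu ht₁ ht₁t htT hB hH w
  calc ‖pairing (heat (t - t₁) (u t₁)) w‖ₑ + ‖∫ s in t₁..t, 𝒜.form (u s) (u s) (heat (t - s) w)‖ₑ
      ≤ eFourierSobolevNorm 10 (u t₁) * eFourierSobolevNorm (-10) w +
          2 * K * ENNReal.ofReal M * ENNReal.ofReal R * eFourierSobolevNorm (-10) w *
            (ENNReal.ofReal Δ + ENNReal.ofReal (2 * Real.sqrt Δ)) := add_le_add h1 h2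
    _ = (eFourierSobolevNorm 10 (u t₁) + 2 * K * ENNReal.ofReal M * ENNReal.ofReal R *
            (ENNReal.ofReal Δ + ENNReal.ofReal (2 * Real.sqrt Δ))) * eFourierSobolevNorm (-10) w := by ring
    _ ≤ (eFourierSobolevNorm 10 (u t₁) + E) * eFourierSobolevNorm (-10) w := by gcongr

end Summit.NavierStokesRegularity.NavierStokesRegularity.Theorems.PerpetualPumpThesis.FB

namespace Summit.NavierStokesRegularity.NavierStokesRegularity.Theorems.PerpetualPumpThesis

open MeasureTheory Set Filter Topology
open scoped ENNReal SchwartzMap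
open Literature.Analysis.FluidPDE Literature.Analysis.FluidPDE.Tao2016
open Literature.Analysis.FunctionSpaces

/-- **Part Form of stub `tameDuhamelBound` (registered sub-goal `stub_FB_Form`)**: the **tame bound for
Tao's averaged form** — for every averaging datum `𝒜` there is `K < ∞` with
`|⟨B̃(f,g), w⟩| ≤ K (‖f‖_{Ḃ⁰_{∞,1}} ‖g‖_{H¹⁰} + ‖f‖_{H¹⁰} ‖g‖_{Ḃ⁰_{∞,1}}) ‖w‖_{H⁻⁹}` for all
divergence-free `f, g` of finite `H¹⁰` norm and all `w ∈ L²(ℝ³; ℂ³)` (the tame estimate for `B` slot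
by slot, slots bounded on `Ḃ⁰_{∞,1}`, `H¹⁰`, `H⁻⁹`, Tao's moment bounds) — the key tame estimate
`‖B̃(f,f)‖_{H⁹} ≲ ‖f‖_{Ḃ⁰_{∞,1}} ‖f‖_{H¹⁰}` of line `SketchIdeator2` in its duality form. -/
theorem stub_FB_Form : ∀ 𝒜 : AveragingDatum, ∃ K : ENNReal, K ≠ ⊤ ∧ ∀ f g w : L2C, IsFourierDivFree f → IsFourierDivFree g → eFourierSobolevNorm 10 f < ⊤ → eFourierSobolevNorm 10 g < ⊤ → ‖𝒜.form f g w‖ₑ ≤ K * (eHomBesovNorm 0 ⊤ 1 ((f : L2C) : 𝓢'(EuclideanSpace ℝ (Fin 3), EuclideanSpace ℂ (Fin 3))) * eFourierSobolevNorm 10 g + eFourierSobolevNorm 10 f * eHomBesovNorm 0 ⊤ 1 ((g : L2C) : 𝓢'(EuclideanSpace ℝ (Fin 3), EuclideanSpace ℂ (Fin 3)))) * eFourierSobolevNorm (-9) w :=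
  fun 𝒜 => FB.exists_enorm_form_le_tame 𝒜


/-- Local notation for physical / frequency space `ℝ³` (as printed by the registered signature). -/
local notation "ℝ³" => EuclideanSpace ℝ (Fin 3)
/-- Local notation for the complexified range `ℂ³` (as printed by the registered signature). -/
local notation "ℂ³" => EuclideanSpace ℂ (Fin 3)

/-- **Stub `tameDuhamelBound` (tag FB) of line `SketchIdeator2` for `PerpetualPump.Thesis`**: the tame
`H¹⁰`–Duhamel a-priori bound along `H¹⁰_df`-mild solutions of the averaged Navier–Stokes equation of
an ARBITRARY averaging datum `𝒜` (Tao 2016, (1.12)–(1.15)): there is `C ≥ 0` such that for every mild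
solution `u` on `[0,T)`, all `0 ≤ t₁ ≤ t < T`, `M, R ≥ 0` with `‖u(s)‖_{Ḃ⁰_{∞,1}} ≤ M` and
`‖u(s)‖_{H¹⁰} ≤ R` on `[t₁,t]`,
`‖u(t)‖_{H¹⁰} ≤ ‖u(t₁)‖_{H¹⁰} + C (√(t-t₁) + (t-t₁)) M R` (heat is an `H¹⁰`-contraction; the tame
paraproduct estimate `|⟨B̃(f,f), h⟩| ≲ ‖f‖_{Ḃ⁰_{∞,1}} ‖f‖_{H¹⁰} ‖h‖_{H⁻⁹}`; the parabolic gain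
`H⁻¹⁰ → H⁻⁹` at cost `1 + σ^{-1/2}`; `H¹⁰` by duality inside `H¹⁰_df`). -/
theorem stub_tameDuhamelBound : ∀ 𝒜 : AveragingDatum, ∃ C : ℝ, 0 ≤ C ∧ ∀ (a : L2C) (T : ℝ) (u : ℝ → L2C), IsMildSolutionFor 𝒜.form a (Ico 0 T) u → ∀ t₁ t M R : ℝ, 0 ≤ t₁ → t₁ ≤ t → t < T → 0 ≤ M → 0 ≤ R → (∀ s ∈ Icc t₁ t, eHomBesovNorm 0 ⊤ 1 ((u s : L2C) : 𝓢'(ℝ³, ℂ³)) ≤ ENNReal.ofReal M) → (∀ s ∈ Icc t₁ t, eFourierSobolevNorm 10 (u s) ≤ ENNReal.ofReal R) → eFourierSobolevNorm 10 (u t) ≤ eFourierSobolevNorm 10 (u t₁) + ENNReal.ofReal (C * (Real.sqrt (t - t₁) + (t - t₁)) * M * R) :=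
  fun 𝒜 => FB.tameDuhamelBound 𝒜

end Summit.NavierStokesRegularity.NavierStokesRegularity.Theorems.PerpetualPumpThesis
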